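import Summits.Ventures.AbcSig.Rows.XTemplateHalves
import Summits.Ventures.AbcSig.Levels.N2272

/-!
# Venture AbcSig — PARITY-HALF ROW `C2aL71A0xyodd`: `xⁿ + 71^m·yⁿ = z²`, `xy` odd (class `a = 0`, [BS04, Thm 1.6] wording) over the NORM-FORM level file 2272 = 32·71 (GENERATED by p-lean g4 `gen4/halfrow.py`)

HONEST FRAMING. A row of a COMPUTATION cell (`pub-abcsig`); a CONDITIONAL theorem, no claim on ABC or any summit.
Hypotheses: `BS04Package` (CITED: [BS04] Lemma 3.3 + (3.1) + Lemma 4.2); `DataComplete 2272` + `RefinesCPSymAll 2272` (COMPUTED: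
certified engine-1 level file; norm-form certificates `Sieve/CharpolyCert.lean`, prime-ideal trees where the norm form is weaker);
the listed per-orbit exclusions `hX_…` (CITED: the row of record's module closures — nothing of them is checked here).
Only the parity half living at the single level 32·71 is claimed (the complementary half needs level 2·71, not certified).
Exponent range: prime `n ≥ 11`, `n ≠ 71`; `1 ≤ m < n`.
Residual of record: none. No cited exclusion needed: every (orbit, exponent ≥ 11) pair is killed in the kernel.
Row of record: `census/rows/C2a/C2a-l71-a0-xyodd.md` (sha16 `a1ac2f130c5d2bc7`; SIGNED 2026-08-22T16:05:08Z by referee (ref-g11)).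
-/

namespace Summit.Ventures.AbcSig

/-- Parity-half row `C2aL71A0xyodd` (`xⁿ + 71^m·yⁿ = z²`, `xy` odd (class `a = 0`, [BS04, Thm 1.6] wording)); prime `n ≥ 11`, `n ≠ 71`; conditional on the named hypotheses. -/
theorem xrow_C2aL71A0xyodd (M : NewformModel) (hP : M.BS04Package)
    (hD2272 : M.DataComplete 2272 level2272Orbits) (hCP2272 : M.RefinesCPSymAll 2272 level2272CP)
    (n : ℕ) (hn : n.Prime) (hmin : 11 ≤ n) (hnℓ : n ≠ 71) (m : ℕ) (hm : 1 ≤ m) (hmn : m < n)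

    (x y z : ℤ) (hxy : ¬ 2 ∣ x * y) (hxy1 : x * y ≠ 1) (hxy2 : x * y ≠ -1) : ¬ IsPrimitiveSolution 1 (2 ^ 0 * 71 ^ m) 1 n x y z := by
  have hℓ : Nat.Prime 71 := by norm_num
  have h7 : 7 ≤ n := by omega
  exact xrowC2a_a0_xyodd 71 hℓ (by norm_num) M hP n hn h7 hnℓ hD2272 m hm hmn
    (level2272_sieve M hP hCP2272 n hn h7 (fun o => M.Excludes 2272 o
      (famB (2 ^ 0 * 71 ^ m) n (fun _ _ => True)) ∨ M.ExcludesStd 2272 o n) (fun _ h => Or.inr h) (fun hmem => by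
      obtain rfl : n = 7 := by simpa using hmem
      omega) (fun hmem => by
      obtain rfl : n = 7 := by simpa using hmem
      omega) (fun hmem => by
      obtain rfl : n = 7 := by simpa using hmem
      omega) (fun hmem => by
      obtain rfl : n = 7 := by simpa using hmem
      omega))
    x y z hxy hxy1 hxy2

end Summit.Ventures.AbcSig
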